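import Mathlib
import HarnessLib
import Literature.MathematicalPhysics.QuantumLattice.SectorisedEffectiveActionBound
import Literature.MathematicalPhysics.QuantumLattice.HubbardSectorFieldSubstitution
import Summits.HubbardSuperconductivity.HubbardSuperconductivity.Theorems.KLProgrammeKLRegimeWickKernelAntisymm
import Summits.HubbardSuperconductivity.HubbardSuperconductivity.Theorems.KLProgrammeKLRegimeKernelNormsLevelsDefs

/-!
# Route `KLProgramme` — ENGINE child (stmt-HubbardSuperconductivity-19918), `stub_engine_step_values` (E2-v9), E2-WICK-ROADMAP §5 (iv):
# the vertex sizes `Na`, `Nb` of the `k + 1`-line term ARE the engine's sectorised norms (plain and WITH LEVELS)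

Cell gate-hubbard-kl, seat p5 (g4).  Sequel of …WickCrossContractionSum/Overlap/Sector.  There the two vertices `a`, `b` (Grassmann polynomials on
sector fields `SpaceTimeIdx × SectorLeg N`) are read through
`Na ≥ Σ_X Σ_{X₀ : X₀ p₀ = z} ‖kernel a (k+1+m₀) (append X X₀)‖` (pinned at a free leg, contracted legs summed) and
`Nb ≥ Σ_y Σ_{Y₁} ‖kernel b (k+1+m₁) (append (cons Y₀ (y,τ)) Y₁)‖` (line-`0` leg fixed, SECTORS `τ` of the other `k` contracted legs prescribed).
For the vertices of the single-scale step, `a = sectorPreimage β F Ga`, `b = sectorPreimage β F Gb` (`SectorisedEffectiveActionBound`: the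
polynomial of the sector fields presented by the sectorised kernels `ε_x^m W_{m,Ω}(x)` of `G`), these are the tree's norms:

* `sectorisedKernel_comp_perm` (the sectorised kernels are totally antisymmetric), `kernel_presented_of_antisymm`, `kernel_sectorPreimage_eq`
  (`kernel (sectorPreimage β F G) m Y = ε_x^m · W_{m, Ω(Y)}(x(Y))` EXACTLY, no antisymmetrisation loss), `norm_kernel_sectorPreimage_le`;
* `pinnedSum_prod_eq_sectorLegSum_prescribed` — pinned sums on product labels with prescribed sectors are the leg sums of
  `sectorisedKernelNorm` over `KLRegimeSplit.prescribedTuples univ Ωe` (the tuple sets of the LEVELS invariant `KernelNormsLevels`, p504160);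
* **`sum_pinned_norm_kernel_sectorPreimage_le`**: `Σ_X Σ_{X₀ : X₀ p₀ = z} ‖kernel (sectorPreimage β F G) (n₁+m₀) (append X X₀)‖ ≤ ε_x · ‖G‖_{n₁+m₀, univ}`;
* **`sum_levels_norm_kernel_sectorPreimage_le`**: `Σ_y Σ_{Y₁} ‖kernel (sectorPreimage β F G) (k+1+m₁) (append (cons Y₀ (y,τ)) Y₁)‖ ≤
  ε_x · ‖G‖_{k+1+m₁, prescribedTuples univ (append (cons none (some∘τ)) none)}` — a norm at LEVEL `k` (`levelCount_levelsPrescription`);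
* the reindexing identities `sum_sum_filter_append_eq`, `sum_sum_append_cons_eq_sum_filter` behind them.

So in `sum_norm_kernel_crossContract_pullback_le` one may take `Na = ε_x·‖Ga‖_{univ}` (the invariant `KernelNormsV4`) and `Nb = ε_x·(the level-k norm of
Gb)` (the invariant `KernelNormsLevels`): the E.5 gain of FKT Prop. XII needs the second vertex ONE LEVEL PER EXTRA LINE higher — the finding of
memo E5-GAIN-SCALE-N §3.  Pure bookkeeping; no definitions, no named facts.  References (locators only): Benfatto–Giuliani–Mastropietro, Ann. Henri
Poincaré 7 (2006) §2.7 (2.70), §2.8 (2.76); Feldman–Knörrer–Trubowitz, Rev. Math. Phys. 15 (2003) Prop. XII.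
-/

noncomputable section

namespace Summit.HubbardSuperconductivity.HubbardSuperconductivity.Theorems.KLRegimeWick

set_option linter.dupNamespace false -- summit = problem name (single-conjunct summit), D-0017

open Literature.MathematicalPhysics.QuantumLattice Literature.Probability.LatticeModels GrassmannAlgebra Finset Matrix
open Summit.HubbardSuperconductivity.HubbardSuperconductivity.Theorems.KLRegimeSplit

/-! ## §1 Reindexing -/

section Reindex

variable {α : Type*} [Fintype α] [DecidableEq α] {A : Type*} [AddCommMonoid A]

omit [DecidableEq α] in
/-- `Σ_X Σ_{X₀} f (append X X₀) = Σ_Y f Y` (`Fin.appendEquiv`). -/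
theorem sum_sum_append_eq {n₁ n₂ : ℕ} (f : (Fin (n₁ + n₂) → α) → A) :
    ∑ X : Fin n₁ → α, ∑ X₀ : Fin n₂ → α, f (Fin.append X X₀) = ∑ Y : Fin (n₁ + n₂) → α, f Y := by
  rw [← Fintype.sum_prod_type']
  exact Fintype.sum_equiv (Fin.appendEquiv n₁ n₂) _ _ fun q => rfl

/-- The same with a leg pinned in the second block: `Σ_X Σ_{X₀ : X₀ p₀ = z} f (append X X₀) = Σ_{Y : Y (natAdd n₁ p₀) = z} f Y`. -/
theorem sum_sum_filter_append_eq {n₁ n₂ : ℕ} (f : (Fin (n₁ + n₂) → α) → A) (p₀ : Fin n₂) (z : α) :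
    ∑ X : Fin n₁ → α, ∑ X₀ ∈ univ.filter (fun X₀ : Fin n₂ → α => X₀ p₀ = z), f (Fin.append X X₀) =
      ∑ Y ∈ univ.filter (fun Y : Fin (n₁ + n₂) → α => Y (Fin.natAdd n₁ p₀) = z), f Y := by
  simp_rw [sum_filter]
  rw [← sum_sum_append_eq]
  refine sum_congr rfl fun X _ => sum_congr rfl fun X₀ _ => ?_
  rw [Fin.append_right]

/-- `Σ_{Yh} Σ_{Y₁} f (append Yh Y₁)` restricted by a condition on the first block. -/
theorem sum_sum_append_cons_eq_sum_filter {P S : Type*} [Fintype P] [Fintype S] [DecidableEq P] [DecidableEq S] {k m₁ : ℕ}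
    (f : (Fin (k + 1 + m₁) → P × S) → A) (Y₀ : P × S) (τ : Fin k → S) :
    ∑ y : Fin k → P, ∑ Y₁ : Fin m₁ → P × S, f (Fin.append (Fin.cons Y₀ (fun i => (y i, τ i)) : Fin (k + 1) → P × S) Y₁) =
      ∑ Y ∈ univ.filter (fun Y : Fin (k + 1 + m₁) → P × S =>
        Y (Fin.castAdd m₁ 0) = Y₀ ∧ ∀ i : Fin k, (Y (Fin.castAdd m₁ i.succ)).2 = τ i), f Y := by
  rw [sum_filter, ← sum_sum_append_eq]
  -- the head block `Yh : Fin (k+1) → P × S` ↦ `(Yh 0, tail)` and the tail ↦ `(positions, sectors)`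
  have hblock : ∀ Y₁ : Fin m₁ → P × S,
      ∑ Yh : Fin (k + 1) → P × S, (if (Fin.append Yh Y₁ (Fin.castAdd m₁ 0) = Y₀ ∧
          ∀ i : Fin k, (Fin.append Yh Y₁ (Fin.castAdd m₁ i.succ)).2 = τ i) then f (Fin.append Yh Y₁) else 0) =
        ∑ y : Fin k → P, f (Fin.append (Fin.cons Y₀ (fun i => (y i, τ i)) : Fin (k + 1) → P × S) Y₁) := by
    intro Y₁
    simp_rw [Fin.append_left]
    rw [← (Fin.consEquiv fun _ : Fin (k + 1) => P × S).sum_comp, Fintype.sum_prod_type]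
    simp only [Fin.consEquiv, Equiv.coe_fn_mk, Fin.cons_zero, Fin.cons_succ]
    simp_rw [ite_and]
    simp_rw [Finset.sum_ite_irrel, Finset.sum_const_zero]
    rw [Finset.sum_ite_eq' univ Y₀, if_pos (mem_univ _),
      ← (Equiv.arrowProdEquivProdArrow (Fin k) (fun _ => P) (fun _ => S)).symm.sum_comp, Fintype.sum_prod_type]
    refine sum_congr rfl fun y _ => ?_
    rw [Finset.sum_eq_single_of_mem τ (mem_univ τ) fun τ' _ hne => ?_]
    · rw [if_pos]
      · rfl
      · intro i; rfl
    · rw [if_neg]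
      intro h
      exact hne (funext fun i => h i)
  calc ∑ y : Fin k → P, ∑ Y₁ : Fin m₁ → P × S, f (Fin.append (Fin.cons Y₀ (fun i => (y i, τ i)) : Fin (k + 1) → P × S) Y₁)
      = ∑ Y₁ : Fin m₁ → P × S, ∑ y : Fin k → P, f (Fin.append (Fin.cons Y₀ (fun i => (y i, τ i)) : Fin (k + 1) → P × S) Y₁) :=
        Finset.sum_comm
    _ = ∑ Y₁ : Fin m₁ → P × S, ∑ Yh : Fin (k + 1) → P × S, (if (Fin.append Yh Y₁ (Fin.castAdd m₁ 0) = Y₀ ∧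
          ∀ i : Fin k, (Fin.append Yh Y₁ (Fin.castAdd m₁ i.succ)).2 = τ i) then f (Fin.append Yh Y₁) else 0) :=
        sum_congr rfl fun Y₁ _ => (hblock Y₁).symm
    _ = _ := Finset.sum_comm

end Reindex

/-! ## §2 The kernels of the sector preimage, exactly -/

section Preimage

variable {L M N : ℕ} [NeZero L]

/-- **The sectorised kernels are totally antisymmetric** (jointly in sectors and positions). -/
theorem sectorisedKernel_comp_perm (β : ℝ) (F : Fin N → FreqMomentum L M → ℂ) (G : HubbardGrassmann L M) {m : ℕ}
    (σ : Equiv.Perm (Fin m)) (Ω : Fin m → SectorLeg N) (x : Fin m → SpaceTimeIdx L M) :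
    sectorisedKernel L M β F G m (Ω ∘ σ) (x ∘ σ) = ((Equiv.Perm.sign σ : ℤ) : ℂ) * sectorisedKernel L M β F G m Ω x := by
  rw [sectorisedKernel_def, sectorisedKernel_def, mul_sum]
  set e : (Fin m → FreqMomentum L M) ≃ (Fin m → FreqMomentum L M) := σ.symm.arrowCongr (Equiv.refl _) with he_def
  have he : ∀ k : Fin m → FreqMomentum L M, e k = k ∘ σ := fun k => by
    funext i; simp [he_def, Equiv.arrowCongr_apply]
  rw [← e.sum_comp]
  refine sum_congr rfl fun k _ => ?_
  rw [he]
  have hprod : (∏ i, F ((Ω ∘ σ) i).1.1 ((k ∘ σ) i) * hubbardPlaneWave L M β ((Ω ∘ σ) i).2 ((k ∘ σ) i) ((x ∘ σ) i)) =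
      ∏ i, F (Ω i).1.1 (k i) * hubbardPlaneWave L M β (Ω i).2 (k i) (x i) :=
    Fintype.prod_equiv σ _ _ fun i => rfl
  have hker : kernel ℂ G m (fun i => (((k ∘ σ) i, ((Ω ∘ σ) i).1.2), ((Ω ∘ σ) i).2)) =
      kernel ℂ G m ((fun i => ((k i, (Ω i).1.2), (Ω i).2)) ∘ σ) := rfl
  rw [hprod, hker, kernel_comp_perm (R := ℂ)]
  ring

/-- **A presentation by an antisymmetric coefficient function has that function as its kernel** (no `1/m! Σ_σ` left over). -/
theorem kernel_presented_of_antisymm {Γ' : Type*} [Fintype Γ'] [DecidableEq Γ'] {m : ℕ} (φ : (Fin m → Γ') → ℂ)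
    (hφ : ∀ (σ : Equiv.Perm (Fin m)) (X : Fin m → Γ'), φ (X ∘ σ) = ((Equiv.Perm.sign σ : ℤ) : ℂ) * φ X) (X : Fin m → Γ') :
    kernel ℂ (presented ℂ φ) m X = φ X := by
  rw [kernel_presented]
  have h : ∀ σ : Equiv.Perm (Fin m), Equiv.Perm.sign σ • φ (X ∘ σ) = φ X := fun σ => by
    rw [hφ, Units.smul_def, zsmul_eq_mul, ← mul_assoc, ← Int.cast_mul, ← Units.val_mul, Int.units_mul_self, Units.val_one,
      Int.cast_one, one_mul]
  simp_rw [h]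
  rw [sum_const, card_univ, Fintype.card_perm, Fintype.card_fin, nsmul_eq_mul, ← mul_assoc, Rat.smul_one_eq_cast, Rat.cast_inv,
    Rat.cast_natCast, inv_mul_cancel₀ (by exact_mod_cast Nat.factorial_ne_zero m), one_mul]

/-- **The kernels of the sector preimage, exactly**: in degree `m ≤ |Γ|`, `kernel (sectorPreimage β F G) m Y = ε_x^m · W_{m,Ω(Y)}(x(Y))`. -/
theorem kernel_sectorPreimage_eq (β : ℝ) (F : Fin N → FreqMomentum L M → ℂ) (G : HubbardGrassmann L M) {m : ℕ}
    (hm : m ≤ Fintype.card (HubbardFieldIdx L M)) (Y : Fin m → SpaceTimeIdx L M × SectorLeg N) :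
    kernel ℂ (sectorPreimage β F G) m Y =
      ((imagTimeWeight β M : ℝ) : ℂ) ^ m * sectorisedKernel L M β F G m (fun i => (Y i).2) (fun i => (Y i).1) := by
  rw [kernel_sectorPreimage, if_pos hm]
  refine kernel_presented_of_antisymm _ (fun σ Y' => ?_) Y
  rw [show (fun i => ((Y' ∘ σ) i).2) = (fun i => (Y' i).2) ∘ σ from rfl,
    show (fun i => ((Y' ∘ σ) i).1) = (fun i => (Y' i).1) ∘ σ from rfl, sectorisedKernel_comp_perm]
  ring

/-- **Norm form, every degree**: `‖kernel (sectorPreimage β F G) m Y‖ ≤ ε_x^m · |W_{m,Ω(Y)}(x(Y))|` (equality for `m ≤ |Γ|`, `0` beyond). -/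
theorem norm_kernel_sectorPreimage_le {β : ℝ} (hβ : 0 ≤ β) (F : Fin N → FreqMomentum L M → ℂ) (G : HubbardGrassmann L M) (m : ℕ)
    (Y : Fin m → SpaceTimeIdx L M × SectorLeg N) :
    ‖kernel ℂ (sectorPreimage β F G) m Y‖ ≤
      imagTimeWeight β M ^ m * ‖sectorisedKernel L M β F G m (fun i => (Y i).2) (fun i => (Y i).1)‖ := by
  by_cases hm : m ≤ Fintype.card (HubbardFieldIdx L M)
  · rw [kernel_sectorPreimage_eq β F G hm, norm_mul, norm_pow, Complex.norm_real, Real.norm_of_nonneg (imagTimeWeight_nonneg hβ M)]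
  · rw [kernel_sectorPreimage, if_neg hm, norm_zero]
    exact mul_nonneg (pow_nonneg (imagTimeWeight_nonneg hβ M) m) (norm_nonneg _)

end Preimage

/-! ## §3 Pinned sums with prescribed sectors are leg sums over `prescribedTuples` -/

section Prescribed

variable {N : ℕ} {P : Type*} [Fintype P] [DecidableEq P]

/-- **Pinned sums on product labels with prescribed sectors are leg sums over `prescribedTuples univ Ωe`**:
`ε^m Σ_{Y : Y p = (x,s), (Y i).2 ∈ Ωe i} ‖W_{Ω(Y)}(x(Y))‖ = sectorLegSum ε (prescribedTuples univ Ωe) W p s x`. -/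
theorem pinnedSum_prod_eq_sectorLegSum_prescribed (ε : ℝ) {m : ℕ} (W : (Fin (m + 1) → SectorLeg N) → (Fin (m + 1) → P) → ℂ)
    (p : Fin (m + 1)) (x : P) (s : SectorLeg N) (Ωe : Fin (m + 1) → Option (SectorLeg N)) :
    ε ^ m * ∑ Y ∈ univ.filter (fun Y : Fin (m + 1) → P × SectorLeg N => Y p = (x, s) ∧ ∀ i, ∀ t ∈ Ωe i, (Y i).2 = t),
        ‖W (fun i => (Y i).2) (fun i => (Y i).1)‖ = sectorLegSum ε (prescribedTuples univ Ωe) W p s x := by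
  rw [sectorLegSum_def, prescribedTuples, filter_filter, ← mul_sum]
  congr 1
  rw [sum_filter, sum_filter, ← (Equiv.arrowProdEquivProdArrow (Fin (m + 1)) (fun _ => P) (fun _ => SectorLeg N)).symm.sum_comp,
    Fintype.sum_prod_type, sum_comm]
  refine sum_congr rfl fun Ω _ => ?_
  split_ifs with hΩ
  · rw [sum_filter]
    refine sum_congr rfl fun X _ => ?_
    split_ifs with h1 h2 h3
    · rfl
    · exact absurd (congrArg Prod.fst h1.1) h2
    · exact absurd ⟨Prod.ext h3 hΩ.2, fun i t ht => hΩ.1 i t ht⟩ h1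
    · rfl
  · refine sum_eq_zero fun X _ => ?_
    rw [if_neg]
    exact fun h => hΩ ⟨fun i t ht => h.2 i t ht, congrArg Prod.snd h.1⟩

end Prescribed

/-! ## §4 The vertex sizes of the sector preimage -/

section Sizes

variable {L M N : ℕ} [NeZero L]

/-- **Pinned sum, core form**: `Σ_{Y : Y q = z} ‖kernel (sectorPreimage β F G) D Y‖ ≤ ε_x · ‖G‖_{D, univ}`. -/
theorem sum_filter_norm_kernel_sectorPreimage_le {β : ℝ} (hβ : 0 ≤ β) (F : Fin N → FreqMomentum L M → ℂ) (G : HubbardGrassmann L M)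
    {D : ℕ} (q : Fin D) (z : SpaceTimeIdx L M × SectorLeg N) :
    ∑ Y ∈ univ.filter (fun Y : Fin D → SpaceTimeIdx L M × SectorLeg N => Y q = z), ‖kernel ℂ (sectorPreimage β F G) D Y‖ ≤
      imagTimeWeight β M * hubbardSectorKernelNorm L M β F (univ : Finset (Fin D → SectorLeg N)) G := by
  obtain ⟨d, rfl⟩ : ∃ d, D = d + 1 := ⟨D - 1, by have := q.pos; omega⟩
  obtain ⟨x, s⟩ := z
  have hε0 : 0 ≤ imagTimeWeight β M := imagTimeWeight_nonneg hβ M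
  calc ∑ Y ∈ univ.filter (fun Y : Fin (d + 1) → SpaceTimeIdx L M × SectorLeg N => Y q = (x, s)),
        ‖kernel ℂ (sectorPreimage β F G) (d + 1) Y‖
      ≤ ∑ Y ∈ univ.filter (fun Y : Fin (d + 1) → SpaceTimeIdx L M × SectorLeg N => Y q = (x, s)),
          imagTimeWeight β M ^ (d + 1) * ‖sectorisedKernel L M β F G (d + 1) (fun i => (Y i).2) (fun i => (Y i).1)‖ :=
        sum_le_sum fun Y _ => norm_kernel_sectorPreimage_le hβ F G (d + 1) Y
    _ = imagTimeWeight β M * sectorLegSum (imagTimeWeight β M) univ (sectorisedKernel L M β F G (d + 1)) q s x := by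
        rw [← pinnedSum_prod_eq_sectorLegSum_univ, ← mul_sum, pow_succ', mul_assoc]
    _ ≤ imagTimeWeight β M * hubbardSectorKernelNorm L M β F (univ : Finset (Fin (d + 1) → SectorLeg N)) G :=
        mul_le_mul_of_nonneg_left (by
          rw [hubbardSectorKernelNorm_def]
          exact sectorLegSum_le_sectorisedKernelNorm _ univ _ q s x) hε0

/-- **Pinned sum with prescribed sectors, core form**:
`Σ_{Y : Y q = z, (Y i).2 ∈ Ωe i} ‖kernel (sectorPreimage β F G) D Y‖ ≤ ε_x · ‖G‖_{D, prescribedTuples univ Ωe}`. -/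
theorem sum_filter_prescribed_norm_kernel_sectorPreimage_le {β : ℝ} (hβ : 0 ≤ β) (F : Fin N → FreqMomentum L M → ℂ)
    (G : HubbardGrassmann L M) {D : ℕ} (q : Fin D) (z : SpaceTimeIdx L M × SectorLeg N) (Ωe : Fin D → Option (SectorLeg N)) :
    ∑ Y ∈ univ.filter (fun Y : Fin D → SpaceTimeIdx L M × SectorLeg N => Y q = z ∧ ∀ i, ∀ t ∈ Ωe i, (Y i).2 = t),
        ‖kernel ℂ (sectorPreimage β F G) D Y‖ ≤
      imagTimeWeight β M * hubbardSectorKernelNorm L M β F (prescribedTuples univ Ωe) G := by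
  obtain ⟨d, rfl⟩ : ∃ d, D = d + 1 := ⟨D - 1, by have := q.pos; omega⟩
  obtain ⟨x, s⟩ := z
  have hε0 : 0 ≤ imagTimeWeight β M := imagTimeWeight_nonneg hβ M
  calc ∑ Y ∈ univ.filter (fun Y : Fin (d + 1) → SpaceTimeIdx L M × SectorLeg N => Y q = (x, s) ∧ ∀ i, ∀ t ∈ Ωe i, (Y i).2 = t),
        ‖kernel ℂ (sectorPreimage β F G) (d + 1) Y‖
      ≤ ∑ Y ∈ univ.filter (fun Y : Fin (d + 1) → SpaceTimeIdx L M × SectorLeg N => Y q = (x, s) ∧ ∀ i, ∀ t ∈ Ωe i, (Y i).2 = t),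
          imagTimeWeight β M ^ (d + 1) * ‖sectorisedKernel L M β F G (d + 1) (fun i => (Y i).2) (fun i => (Y i).1)‖ :=
        sum_le_sum fun Y _ => norm_kernel_sectorPreimage_le hβ F G (d + 1) Y
    _ = imagTimeWeight β M * sectorLegSum (imagTimeWeight β M) (prescribedTuples univ Ωe) (sectorisedKernel L M β F G (d + 1)) q s x := by
        rw [← pinnedSum_prod_eq_sectorLegSum_prescribed, ← mul_sum, pow_succ', mul_assoc]
    _ ≤ imagTimeWeight β M * hubbardSectorKernelNorm L M β F (prescribedTuples univ Ωe) G :=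
        mul_le_mul_of_nonneg_left (by
          rw [hubbardSectorKernelNorm_def]
          exact sectorLegSum_le_sectorisedKernelNorm _ _ _ q s x) hε0

/-- **`Na` of the glued bound is the plain sectorised norm**: pinned at the free leg `p₀`, the `n₁` contracted legs summed,
`Σ_X Σ_{X₀ : X₀ p₀ = z} ‖kernel (sectorPreimage β F G) (n₁ + m₀) (append X X₀)‖ ≤ ε_x · ‖G‖_{n₁+m₀, univ}`. -/
theorem sum_pinned_norm_kernel_sectorPreimage_le {β : ℝ} (hβ : 0 ≤ β) (F : Fin N → FreqMomentum L M → ℂ) (G : HubbardGrassmann L M)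
    {n₁ m₀ : ℕ} (p₀ : Fin m₀) (z : SpaceTimeIdx L M × SectorLeg N) :
    ∑ X : Fin n₁ → SpaceTimeIdx L M × SectorLeg N,
      ∑ X₀ ∈ univ.filter (fun X₀ : Fin m₀ → SpaceTimeIdx L M × SectorLeg N => X₀ p₀ = z),
        ‖kernel ℂ (sectorPreimage β F G) (n₁ + m₀) (Fin.append X X₀)‖ ≤
      imagTimeWeight β M * hubbardSectorKernelNorm L M β F (univ : Finset (Fin (n₁ + m₀) → SectorLeg N)) G := by
  rw [sum_sum_filter_append_eq (fun Y => ‖kernel ℂ (sectorPreimage β F G) (n₁ + m₀) Y‖) p₀ z]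
  exact sum_filter_norm_kernel_sectorPreimage_le hβ F G _ z

omit [NeZero L] in
/-- The LEVELS prescription «line-`0` leg free, legs `1 … k` of the first block in the sectors `τ`, the `m₁` free legs free»,
`append (cons none (some ∘ τ)) (fun _ => none)`, holds at a tuple iff the legs `1 … k` of the first block carry the sectors `τ`. -/
theorem levelsPrescription_iff {k m₁ : ℕ} (τ : Fin k → SectorLeg N) (Y : Fin (k + 1 + m₁) → SpaceTimeIdx L M × SectorLeg N) :
    (∀ i, ∀ t ∈ Fin.append (Fin.cons none (fun i => some (τ i)) : Fin (k + 1) → Option (SectorLeg N)) (fun _ : Fin m₁ => none) i,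
      (Y i).2 = t) ↔ ∀ i : Fin k, (Y (Fin.castAdd m₁ i.succ)).2 = τ i := by
  constructor
  · intro h i
    refine h (Fin.castAdd m₁ i.succ) (τ i) ?_
    simp
  · intro h j
    refine Fin.addCases (fun j' => ?_) (fun j' => ?_) j
    · refine Fin.cases ?_ (fun i => ?_) j'
      · simp
      · intro t ht
        simp only [Fin.append_left, Fin.cons_succ, Option.mem_def, Option.some.injEq] at ht
        rw [← ht]; exact h i
    · simp

/-- **The level of that prescription is `k`** (one prescribed sector per extra line): `levelCount = k`. -/
theorem levelCount_levelsPrescription {k m₁ : ℕ} (τ : Fin k → SectorLeg N) :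
    levelCount (Fin.append (Fin.cons none (fun i => some (τ i)) : Fin (k + 1) → Option (SectorLeg N)) (fun _ : Fin m₁ => none)) = k := by
  rw [levelCount]
  -- the prescribed legs are exactly `castAdd m₁ ∘ succ`
  have hset : (univ.filter fun i : Fin (k + 1 + m₁) =>
      (Fin.append (Fin.cons none (fun i => some (τ i)) : Fin (k + 1) → Option (SectorLeg N)) (fun _ : Fin m₁ => none) i).isSome) =
      (univ : Finset (Fin k)).map ⟨fun i => Fin.castAdd m₁ i.succ, fun i j hij => by
        simpa [Fin.ext_iff] using hij⟩ := by
    ext j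
    simp only [mem_filter, mem_univ, true_and, mem_map, Function.Embedding.coeFn_mk]
    constructor
    · intro hj
      induction j using Fin.addCases with
      | left j' =>
        induction j' using Fin.cases with
        | zero => simp at hj
        | succ i => exact ⟨i, rfl⟩
      | right j' => simp at hj
    · rintro ⟨i, rfl⟩
      simp
  rw [hset, card_map, card_univ, Fintype.card_fin]

/-- **`Nb` of the glued bound is the sectorised norm WITH LEVELS**: line-`0` leg fixed at `Y₀`, the sectors `τ` of the other `k` contracted legs
prescribed, the `m₁` free legs summed:
`Σ_y Σ_{Y₁} ‖kernel (sectorPreimage β F G) (k+1+m₁) (append (cons Y₀ (y,τ)) Y₁)‖ ≤ ε_x · ‖G‖_{k+1+m₁, prescribedTuples univ (append (cons none (some∘τ)) none)}`. -/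
theorem sum_levels_norm_kernel_sectorPreimage_le {β : ℝ} (hβ : 0 ≤ β) (F : Fin N → FreqMomentum L M → ℂ) (G : HubbardGrassmann L M)
    {k m₁ : ℕ} (Y₀ : SpaceTimeIdx L M × SectorLeg N) (τ : Fin k → SectorLeg N) :
    ∑ y : Fin k → SpaceTimeIdx L M, ∑ Y₁ : Fin m₁ → SpaceTimeIdx L M × SectorLeg N,
        ‖kernel ℂ (sectorPreimage β F G) (k + 1 + m₁)
          (Fin.append (Fin.cons Y₀ (fun i => (y i, τ i)) : Fin (k + 1) → SpaceTimeIdx L M × SectorLeg N) Y₁)‖ ≤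
      imagTimeWeight β M * hubbardSectorKernelNorm L M β F (prescribedTuples univ
        (Fin.append (Fin.cons none (fun i => some (τ i)) : Fin (k + 1) → Option (SectorLeg N)) (fun _ : Fin m₁ => none))) G := by
  rw [sum_sum_append_cons_eq_sum_filter (fun Y => ‖kernel ℂ (sectorPreimage β F G) (k + 1 + m₁) Y‖) Y₀ τ]
  have hfilter : (univ.filter fun Y : Fin (k + 1 + m₁) → SpaceTimeIdx L M × SectorLeg N =>
      Y (Fin.castAdd m₁ 0) = Y₀ ∧ ∀ i : Fin k, (Y (Fin.castAdd m₁ i.succ)).2 = τ i) =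
      univ.filter fun Y : Fin (k + 1 + m₁) → SpaceTimeIdx L M × SectorLeg N =>
        Y (Fin.castAdd m₁ 0) = Y₀ ∧ ∀ i, ∀ t ∈ Fin.append (Fin.cons none (fun i => some (τ i)) : Fin (k + 1) → Option (SectorLeg N))
          (fun _ : Fin m₁ => none) i, (Y i).2 = t :=
    filter_congr fun Y _ => by rw [levelsPrescription_iff]
  rw [hfilter]
  exact sum_filter_prescribed_norm_kernel_sectorPreimage_le hβ F G _ Y₀ _

end Sizes

end Summit.HubbardSuperconductivity.HubbardSuperconductivity.Theorems.KLRegimeWick
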